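import Summits.FinalStateConjecture.FinalStateConjecture.Theorems.PhotonSphereChannelsTameEternalLimitDefs
import HarnessLib

/-!
# Route PhotonSphereChannels · crux `ChannelsResolveTameDevelopmentsR` (stmt-FinalStateConjecture-14075) —
# posited objects of the line `trapped-set-observability-analyticity`, part 2: presented dark
# exteriors, linear waves on them, the (energy-comparable) two-sided concentration law, strip
# analyticity, presentations, horizon census (route-posited definitions, D-0016 `<Route>Defs` convention)

Second half of the line's vocabulary, moved VERBATIM (same names, bodies, docstrings) out of the crux
workfile `Cruxes/ChannelsResolveTameDevelopmentsR/Lines/trapped_set_observability_analyticity.lean`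
as RESHAPED by the lead after wave 1 (Reshape 1, lead prover-line-stmt-FinalStateConjecture-14075-c1-0;
planner planner-cruxplan-stmt-FinalStateConjecture-14075-trapped-set-observab-0): `cyl`,
`IsPresentedDarkExterior`, `boxAt`, `eOne`, `eTwo`, `sliceEnergy`, `sliceEnergyTwo`,
`shellExteriorEnergy`, `TwoSidedConcentrationLawK` (the energy-comparable law — the filed `K`-free law
was found FALSE on black-hole members by worker S4 and is not carried), `StripAnalytic`,
`presentationBackground`, `TameEternalLimit.presentedMetric`, `TameEternalLimit.IsPresentedBy`,
`TameEternalLimit.HasSphericalHorizonSections` (the census hypothesis S3 needs and S2 supplies) — all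
over existing declarations (`MetricCoord.{IsMetricOn, sharpAt, chrAt, ricAt, mtrAt}`, `Kerr.radius`,
`Minkowski.bilin`, `E4.{dx, basisVector, spatialNorm, ofTimeSpace}`, `Spacetime.deviationExtend`,
Mathlib calculus / `lintegral` / `DifferentiableOn ℂ` / `Homeomorph` / `Metric.sphere`) and part 1
(`PhotonSphereChannelsTameEternalLimitDefs.lean`, p97253). §API: `mem_cyl`, `cyl_eq_univ_of_neg` (for
`r₀ < 0` the presentation cylinder is ALL of `E4`; registered sub-goal `stub_cylEqUnivOfNeg`) and
`TameEternalLimit.hasSphericalHorizonSections_of_horizon_eq_empty` (the census is vacuous on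
horizonless limits; registered sub-goal `stub_sphericalSectionsOfHorizonEmpty`). Nothing here restates
a route item; the stubs stay in the crux workfile until proved.
-/

set_option linter.dupNamespace false

noncomputable section
namespace Summit.FinalStateConjecture.FinalStateConjecture.Theorems.TrappedSet

open Literature.Geometry.Lorentzian
open scoped Manifold ContDiff Topology ENNReal NNReal BigOperators
open Filter Set Function TopologicalSpace MeasureTheory

/-! ## §1b Vocabulary of the line `trapped-set-observability-analyticity`: presented dark exteriors, linear waves on them, the two-sided
concentration law, strip analyticity, presentations of a limit (all over existing declarations:
`MetricCoord.{IsMetricOn, sharpAt, chrAt, ricAt, mtrAt}`, `Kerr.radius`, `Minkowski.bilin`,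
`E4.{dx, basisVector, spatialNorm, ofTimeSpace}`, `Spacetime.deviationExtend`, Mathlib calculus /
`lintegral` / `DifferentiableOn ℂ`). -/

/-- The **presentation cylinder** `{x ∈ E4 | r₀ < r(a, x)}` (Kerr–Schild oblate radius `r(a,·)`): for
`r₀ > 0` this is `Kerr.region a r₀` (an excised eternal cylinder `ℝ_t × {r > r₀}`), for `r₀ < 0` it is
ALL of `E4` (the presentation domain of a horizonless limit).  Invariant under `t`-translation.
[cite: arXiv08110354, §5.1] -/
def cyl (a r₀ : ℝ) : Opens E4 :=
  ⟨{x | r₀ < Kerr.radius a x}, isOpen_lt continuous_const (Kerr.continuous_radius a)⟩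

/-- **Dark eternal harmonic exterior, presented** — the hypothesis class of the eternal-exterior items
`EternalExteriorStationary` / `LeakageTimeAnalyticity` / `TimeAnalyticLiouville` (stmt-10170/10225/10226)
with two deliberate changes: the clause `0 < r₀` is DROPPED (so `r₀ < 0`, domain `E4`, collar clause
vacuous, presents horizonless objects) and asymptotic flatness is WEAKENED from stationary rates to `1/ρ`
symbols + two-sided non-radiation at order `1/ρ` (what ω-limits of admissible developments inherit:
`LocalSubconvergence.FarChartsConverge.norm_iteratedFDeriv_mul_le`).  Clauses: `G` is a smooth symmetric
invertible metric on the cylinder; slices `{t = const}` uniformly spacelike (`g⁻¹(dt,dt) ≤ −c₀`) and an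
EXCISION COLLAR `{r < r₀ + δ}` on which `dr` is uniformly timelike with `g⁻¹(dt,dr) ≥ c₀` (spacelike
inflow boundary inside the black hole — the chart shadow of `κ > 0`); `Ric(G) = 0`; harmonic gauge
`g^{αβ}Γ^μ_{αβ} = 0`; every `C^k` norm of `G` and `‖G⁻¹‖` bounded on the whole (eternal) cylinder;
`‖G − η‖ ρ ≤ C`, `‖DG‖ ρ ≤ C`, `‖D²G‖ ρ ≤ C` (`ρ = |x⃗|`); `ρ ‖D^m ∂₀G‖ → 0` as `ρ → ∞` uniformly in `t`,
`m ≤ 2` (no news out, none in, ever).  [cite: AlexakisSchlue2018, Thm. 1.1] -/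
def IsPresentedDarkExterior (a r₀ : ℝ) (G : E4 → E4 →L[ℝ] E4 →L[ℝ] ℝ) : Prop :=
  MetricCoord.IsMetricOn G (cyl a r₀ : Set E4) ∧
  (∃ c₀ δ : ℝ, 0 < c₀ ∧ 0 < δ ∧ ∀ x ∈ (cyl a r₀ : Set E4),
      (E4.dx 0) (MetricCoord.sharpAt G x (E4.dx 0)) ≤ -c₀ ∧
      (Kerr.radius a x < r₀ + δ →
        (fderiv ℝ (Kerr.radius a) x) (MetricCoord.sharpAt G x (fderiv ℝ (Kerr.radius a) x)) ≤ -c₀ ∧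
        c₀ ≤ (E4.dx 0) (MetricCoord.sharpAt G x (fderiv ℝ (Kerr.radius a) x)))) ∧
  (∀ x ∈ (cyl a r₀ : Set E4), MetricCoord.ricAt G x = 0) ∧
  (∀ x ∈ (cyl a r₀ : Set E4),
      ∑ β : Fin 4, MetricCoord.chrAt G x (MetricCoord.sharpAt G x (E4.dx β)) (E4.basisVector β) = 0) ∧
  (∀ k : ℕ, ∃ C : ℝ, ∀ x ∈ (cyl a r₀ : Set E4), ‖iteratedFDeriv ℝ k G x‖ ≤ C ∧ ‖MetricCoord.sharpAt G x‖ ≤ C) ∧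
  (∃ C : ℝ, ∀ x ∈ (cyl a r₀ : Set E4), ‖G x - Minkowski.bilin‖ * E4.spatialNorm x ≤ C ∧
      ‖iteratedFDeriv ℝ 1 G x‖ * E4.spatialNorm x ≤ C ∧ ‖iteratedFDeriv ℝ 2 G x‖ * E4.spatialNorm x ≤ C) ∧
  (∀ m : ℕ, m ≤ 2 → ∀ ε : ℝ, 0 < ε → ∃ R' : ℝ, ∀ x ∈ (cyl a r₀ : Set E4), R' < E4.spatialNorm x →
      ‖iteratedFDeriv ℝ m (fun y ↦ fderiv ℝ G y (E4.basisVector 0)) x‖ * E4.spatialNorm x ≤ ε)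

/-- The **coordinate d'Alembertian** of a scalar `u` for the components `G` at `x`:
`□_G u = g^{μν}(∂_μ∂_ν u − Γ^λ_{μν} ∂_λ u)`, written as the metric trace of the Hessian minus the
contracted-Christoffel term (which vanishes in harmonic gauge). [cite: ONeill1983, Ch. 3, Lemma 3.36] -/
def boxAt (G : E4 → E4 →L[ℝ] E4 →L[ℝ] ℝ) (u : E4 → ℝ) (x : E4) : ℝ :=
  MetricCoord.mtrAt G x (fderiv ℝ (fderiv ℝ u) x) -
    fderiv ℝ u x (∑ β : Fin 4, MetricCoord.chrAt G x (MetricCoord.sharpAt G x (E4.dx β)) (E4.basisVector β))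

/-- First-order coordinate energy density `∑_μ (∂_μ u)²` (positive definite; equivalent to every
geometric energy density under the uniform bounds of a presented exterior). [folklore] -/
def eOne (u : E4 → ℝ) (x : E4) : ℝ :=
  ∑ μ : Fin 4, (fderiv ℝ u x (E4.basisVector μ)) ^ 2

/-- Second-order coordinate energy density `∑_{μ,ν} (∂_μ∂_ν u)²` (its ratio to `eOne` is the squared
"effective frequency" of the concentration law). [folklore] -/
def eTwo (u : E4 → ℝ) (x : E4) : ℝ :=
  ∑ μ : Fin 4, ∑ ν : Fin 4, (fderiv ℝ (fderiv ℝ u) x (E4.basisVector μ) (E4.basisVector ν)) ^ 2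

/-- **Slice energy** `E₁[u](t) = ∫_{y : (t,y) ∈ cyl} ∑_μ (∂_μ u)²(t,y) dy ∈ [0,∞]` on the slice
`{x⁰ = t}` of the presentation cylinder. [folklore] -/
def sliceEnergy (a r₀ : ℝ) (u : E4 → ℝ) (t : ℝ) : ℝ≥0∞ :=
  ∫⁻ y in {y : E3 | E4.ofTimeSpace t y ∈ (cyl a r₀ : Set E4)}, ENNReal.ofReal (eOne u (E4.ofTimeSpace t y))

/-- **Second-order slice energy** `E₂[u](t) = ∫ ∑_{μ,ν} (∂_μ∂_ν u)²(t,y) dy`. [folklore] -/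
def sliceEnergyTwo (a r₀ : ℝ) (u : E4 → ℝ) (t : ℝ) : ℝ≥0∞ :=
  ∫⁻ y in {y : E3 | E4.ofTimeSpace t y ∈ (cyl a r₀ : Set E4)}, ENNReal.ofReal (eTwo u (E4.ofTimeSpace t y))

/-- **Energy outside the shell** `{r₁ ≤ r(a,·) ≤ r₂}` on the slice `{x⁰ = t}`: the part of `E₁[u](t)`
carried by `{r < r₁} ∪ {r > r₂}` (near the excision/horizon end and in the far zone). [folklore] -/
def shellExteriorEnergy (a r₀ r₁ r₂ : ℝ) (u : E4 → ℝ) (t : ℝ) : ℝ≥0∞ :=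
  ∫⁻ y in {y : E3 | E4.ofTimeSpace t y ∈ (cyl a r₀ : Set E4) ∧
      (Kerr.radius a (E4.ofTimeSpace t y) < r₁ ∨ r₂ < Kerr.radius a (E4.ofTimeSpace t y))},
    ENNReal.ofReal (eOne u (E4.ofTimeSpace t y))

/-- **The two-sided concentration law, energy-comparable form** (`K`-version; Reshape 1). THE LEVER of
the line in its frequency-free, consumable form — corrected after wave 1: the filed law (same text WITHOUT the
comparability hypothesis `E₁[u](t₀−T) ≤ K·E₁[u](t₀+T)`) is FALSE on every black-hole member of the class, because
`E₁` is not conserved on a cylinder with an absorbing outflow collar (a large ingoing DECOY inside the shell at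
`t₀ − T`, swallowed through `r = r₀` before `t₀`, plus a small incoming pulse arriving in the shell at `t₀ + T`,
satisfies both concentration hypotheses for every `T` with `E₂/E₁(t₀)` bounded; independently the backward
blue-shift layer makes the `t₀ − T` side free). With `K` quantified BEFORE `δ`, parcels bookkeeping forces genuine
two-sided dwelling energy `≳ E₁(t₀−T)/K` once `δ < 1/(K+1)`, and the statement reduces to its intended microlocal
content: for every shell `{r₁ ≤ r ≤ r₂}` and every `K` there are `δ ∈ (0,1)` and `C ≥ 0` such that every `C²`
solution of `□_G u = 0` on the cylinder with finite, non-zero slice energies, `(1−δ)`-concentrated INSIDE the shell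
at the two times `t₀ ∓ T` and with `E₁(t₀−T) ≤ K E₁(t₀+T)`, satisfies `T ≤ C · (1 + log (1 + E₂[u](t₀)/E₁[u](t₀)))`
— two-sided dwelling time is at most logarithmic in the effective frequency AT THE CENTRE (normally hyperbolic
photon region, exponent `ν`; red-shift `κ ≥ κ₀`; `C ≍ C(K)·max (1/2ν, 1/κ₀)`); STABLE trapping or a degenerate
horizon violate it. On the flat members (`r₀ < 0`) it holds with no logarithm (two-sided exterior channels of
energy in `ℝ^{1+3}`). [cite: WunschZworski2011, Thm. 1] [cite: Dyatlov2016SpectralGaps, Thm. 1] -/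
def TwoSidedConcentrationLawK (a r₀ : ℝ) (G : E4 → E4 →L[ℝ] E4 →L[ℝ] ℝ) : Prop :=
  ∀ r₁ r₂ K : ℝ, ∃ δ : ℝ, 0 < δ ∧ δ < 1 ∧ ∃ C : ℝ, 0 ≤ C ∧
    ∀ u : E4 → ℝ, ContDiffOn ℝ 2 u (cyl a r₀ : Set E4) → (∀ x ∈ (cyl a r₀ : Set E4), boxAt G u x = 0) →
      (∀ t : ℝ, sliceEnergy a r₀ u t ≠ ⊤) →
      ∀ t₀ T : ℝ, 0 ≤ T → sliceEnergy a r₀ u t₀ ≠ 0 → sliceEnergyTwo a r₀ u t₀ ≠ ⊤ →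
        shellExteriorEnergy a r₀ r₁ r₂ u (t₀ + T) ≤ ENNReal.ofReal δ * sliceEnergy a r₀ u (t₀ + T) →
        shellExteriorEnergy a r₀ r₁ r₂ u (t₀ - T) ≤ ENNReal.ofReal δ * sliceEnergy a r₀ u (t₀ - T) →
        sliceEnergy a r₀ u (t₀ - T) ≤ ENNReal.ofReal K * sliceEnergy a r₀ u (t₀ + T) →
          T ≤ C * (1 + Real.log (1 + (sliceEnergyTwo a r₀ u t₀).toReal / (sliceEnergy a r₀ u t₀).toReal))

/-- **Strip analyticity in `t`** of the components on the cylinder — VERBATIM the conclusion of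
`LeakageWritesInInk.LeakageTimeAnalyticity` (stmt-10225) / the strip hypothesis of
`TimeAnalyticLiouville` (stmt-10226): there are `σ > 0` and `C` such that every component
`s ↦ G(x + s e₀)(v,w)` is the restriction of a function holomorphic on `{|Im z| < σ}` bounded by
`C‖v‖‖w‖`, uniformly over the cylinder. [cite: Tataru1999PartiallyAnalytic, Thm. 1] -/
def StripAnalytic (a r₀ : ℝ) (G : E4 → E4 →L[ℝ] E4 →L[ℝ] ℝ) : Prop :=
  ∃ σ C : ℝ, 0 < σ ∧ ∀ x ∈ (cyl a r₀ : Set E4), ∀ v w : E4, ∃ F : ℂ → ℂ,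
    DifferentiableOn ℂ F {z : ℂ | |z.im| < σ} ∧ (∀ z : ℂ, |z.im| < σ → ‖F z‖ ≤ C * ‖v‖ * ‖w‖) ∧
      ∀ s : ℝ, F (s : ℂ) = ((G (x + s • E4.basisVector 0) v w : ℝ) : ℂ)

/-- The reference background of a presentation: the cylinder `cyl a r₀`, reference bilinear form `0`
(so that `Spacetime.deviation` IS the pulled-back metric), time `x⁰`, radius `r(a,·)`. [folklore] -/
def presentationBackground (a r₀ : ℝ) : ModelBackground :=
  ⟨cyl a r₀, 0, fun x ↦ x 0, Kerr.radius a⟩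

namespace TameEternalLimit

variable (E : TameEternalLimit)

/-- The **presented metric components** `G = Ξ^* g_Z` of the limit in a chart `Ξ` of the cylinder
(`Spacetime.deviationExtend` against the zero reference form, extended by `0` off the cylinder).
[cite: Anderson2004, Def. 1.1] -/
def presentedMetric (a r₀ : ℝ) (Ξ : cyl a r₀ → E.Z.carrier) : E4 → E4 →L[ℝ] E4 →L[ℝ] ℝ :=
  E.Z.deviationExtend (presentationBackground a r₀) Ξ

/-- **`Ξ` presents the limit `E` on the cylinder `cyl a r₀`** (triage (H1) made a structure): `Ξ` is an
injective smooth local diffeomorphism of the cylinder into `Z` (a global chart of its image) whose image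
covers the closure of the domain of outer communications of the far end (d.o.c. ∪ event horizon; for
`r₀ > 0` the collar `{r₀ < r < r₀ + δ}` is mapped behind the horizon), which is future-oriented
(`Ξ_*(−(dx⁰)^♯)`, the future normal to the slices, is future-directed in `Z`), and in which the metric
components `G = Ξ^*g` form a presented dark eternal harmonic exterior. [cite: Anderson2004, Def. 1.1] -/
structure IsPresentedBy (a r₀ : ℝ) (Ξ : cyl a r₀ → E.Z.carrier) : Prop where
  isLocalDiffeomorph : IsLocalDiffeomorph 𝓘(ℝ, Literature.Geometry.Lorentzian.E4) (𝓡 4) (⊤ : ℕ∞) Ξ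
  injective : Function.Injective Ξ
  covers : closure E.doc ⊆ Set.range Ξ
  future : ∀ x : cyl a r₀, E.Z.timeOrientation.IsFutureDirected
    (mfderiv 𝓘(ℝ, Literature.Geometry.Lorentzian.E4) (𝓡 4) Ξ x
      (-(MetricCoord.sharpAt (E.presentedMetric a r₀ Ξ) x.1 (E4.dx 0))))
  dark : IsPresentedDarkExterior a r₀ (E.presentedMetric a r₀ Ξ)

end TameEternalLimit


namespace TameEternalLimit

/-- **Horizon census: the clock sections of the limit horizon are single round spheres** (Reshape 1; the
hypothesis the presentation stub S3 needs and the reshaped S2 supplies): for every clock level `c`, the section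
`𝓗 ∩ {t = c}`, if nonempty, is homeomorphic to `S²`. It says at once "connected" (ONE component: no eternal dark
multi-black-hole limit — Neugebauer–Hennig non-existence of stationary two-hole vacua is its stationary shadow; the
dynamical statement is open) and "spherical" (Hawking / Chruściel–Wald / Galloway–Schoen horizon topology). An
injective local diffeomorphism of ONE cylinder `cyl a r₀` covering `closure doc = doc ∪ 𝓗` forces it, which is why
it must be explicit. Vacuous when the horizon is empty. [cite: ChruscielCosta2008, §2] -/
def HasSphericalHorizonSections (E : TameEternalLimit) : Prop :=
  ∀ c : ℝ, (E.horizon ∩ {p | E.t p = c}).Nonempty →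
    Nonempty ((E.horizon ∩ {p | E.t p = c} : Set E.Z.carrier) ≃ₜ Metric.sphere (0 : E3) 1)

end TameEternalLimit


/-! ## §API -/

/-- Membership in the presentation cylinder. [folklore] -/
@[simp] theorem mem_cyl {a r₀ : ℝ} {x : E4} : x ∈ (cyl a r₀ : Set E4) ↔ r₀ < Kerr.radius a x :=
  Iff.rfl

/-- **For `r₀ < 0` the presentation cylinder is all of `E4`** (the oblate radius is nonnegative):
the presentation domain of a horizonless limit. [folklore] -/
theorem cyl_eq_univ_of_neg (a : ℝ) {r₀ : ℝ} (h : r₀ < 0) : (cyl a r₀ : Set E4) = Set.univ :=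
  Set.eq_univ_of_forall fun x ↦ (mem_cyl).2 (h.trans_le (Kerr.radius_nonneg a x))

/-- Registered sub-goal `stub_cylEqUnivOfNeg` (statement of `cyl_eq_univ_of_neg` as a closed
`Prop`). [folklore] -/
theorem stub_cylEqUnivOfNeg : ∀ (a r₀ : ℝ), r₀ < 0 → (cyl a r₀ : Set E4) = Set.univ :=
  fun a _ h ↦ cyl_eq_univ_of_neg a h

namespace TameEternalLimit

/-- **The horizon census is vacuous on horizonless limits.** [folklore] -/
theorem hasSphericalHorizonSections_of_horizon_eq_empty (E : TameEternalLimit) (h : E.horizon = ∅) :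
    E.HasSphericalHorizonSections := by
  intro c hc
  obtain ⟨p, hp, -⟩ := hc
  simp [h] at hp

end TameEternalLimit

/-- Registered sub-goal `stub_sphericalSectionsOfHorizonEmpty` (statement of
`TameEternalLimit.hasSphericalHorizonSections_of_horizon_eq_empty` as a closed `Prop`). [folklore] -/
theorem stub_sphericalSectionsOfHorizonEmpty :
    ∀ E : TameEternalLimit, E.horizon = ∅ → E.HasSphericalHorizonSections :=
  fun E h ↦ E.hasSphericalHorizonSections_of_horizon_eq_empty h

end Summit.FinalStateConjecture.FinalStateConjecture.Theorems.TrappedSet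

end
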